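import Summits.BirchSwinnertonDyer.BirchSwinnertonDyer.Theorems.KatoDescentPotSupersingularKatoFiniteLevelStrictRat
import Literature.NumberTheory.EllipticCurves.LocalTorsionInvariants
import Literature.NumberTheory.EllipticCurves.LocalPointsIntegersSubgroup
import HarnessLib

/-!
# Kato's (14.9.3) at finite level, part 8: the local torsion bound (heP) DISCHARGED at EVERY finite place —
# `E(K_v)[p^∞]` is killed by the `p`-part of the index of a torsion-free subgroup of `E(K_v)` (Silverman VII.6.3)
# — so the count `∃ k₀ ∀ k ≥ k₀: #H¹(O_K[1/p],E[p^k]) = #Sel_str^{ur}(K,E[p^∞])·∏_{v∣p}#𝓚_v` needs only the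
# finiteness of `Sel_str^{ur}` and the Poitou–Tate family
# (route `KatoDescentPotSupersingular` / `…Tame…`, crux M = stmt-BirchSwinnertonDyer-19196; route-free helper)

Seat `bsd-potss-rkm` g17 (prover; cell `bsd-potss`), item stmt-BirchSwinnertonDyer-19196 `ReducibleKatoMember`
(`--supports … --as helper`; closes nothing).  HONEST FRAMING: BSD is not proved by any of this; nothing is booked;
theorems only (no definition, no named fact).  Sequel of parts 6–7 (`…StrictFinal`, `…StrictRat`).

## What

* **`exists_pow_nsmul_eq_zero_of_fixed_toLocal`** — for every finite place `v` of `K` (above `p` OR not) there is `e`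
  with `p^e · x = 0` for every `Γ_{K_v}`-fixed `x ∈ E[p^∞]` (`E[p^∞]|_{Γ_{K_v}}` = `GaloisRep.toLocal v (primaryGaloisModule W p)`):
  `E(K_v)` has a torsion-free subgroup `U` of finite index `t` (tree theorem
  `WeierstrassCurve.exists_finiteIndex_torsionFree_adicCompletion`, Silverman VII.6.3 / Milne I 3.3), so `t` kills every
  `K_v`-rational torsion point; a `Γ_{K_v}`-fixed `x ∈ E[p^j]` IS a rational `p^j`-torsion point (Galois descent,
  tree `WeierstrassCurve.invariantsTorsionEquivKerZSMul`), hence `t · x = 0`, and with `t = p^a u`, `p ∤ u`,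
  `p^a · x = 0` (`gcd(u, p^j) = 1`).
* **`exists_forall_le_natCard_selmerGroup_relaxed_eq'`** (any `K : Type`) and **`…_rat'`** (`K = ℚ`, `P = {v_p}`) — the
  counts of parts 6–7 with (heP) discharged: hypotheses left are the finiteness of `Sel_str^{ur}(K,E[p^∞])` and the
  Poitou–Tate family (`SelmerComplement` for THE invariant maps), `p` odd, `T ⊇` bad places `∪ P`.

References: J. H. Silverman, *AEC* VII.6.3, VIII §1 [SilvermanAEC2009]; J. S. Milne, *ADT* I Lemma 3.3 [MilneADT2006];
K. Kato, Astérisque 295 (2004) (14.9.3), Prop. 14.16 [Kato2004Asterisque].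
-/

-- the summit and its single problem are both named `BirchSwinnertonDyer` (registry layout D-0017)
set_option linter.dupNamespace false
set_option autoImplicit false

noncomputable section

open scoped Classical ContRepresentation NumberField
open Function Field NumberField IsDedekindDomain WeierstrassCurve
open Literature.NumberTheory.EllipticCurves Literature.NumberTheory.GaloisRepresentations
  Literature.NumberTheory.GaloisRepresentations.DiscreteGaloisModule Literature.NumberTheory.GaloisCohomology
open Literature.NumberTheory.EllipticCurves.Kato2004
open Summit.BirchSwinnertonDyer.Rank1Residual.X11b.Levels Summit.BirchSwinnertonDyer.Rank1Residual.X11b.LocBridge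
open Summit.BirchSwinnertonDyer.Rank1Residual.GaloisImage

universe u

namespace Summit.BirchSwinnertonDyer.BirchSwinnertonDyer.Theorems.KatoFiniteLevelCount

/-! ## §1 `E(K_v)[p^∞]` is killed by a power of `p`, at every finite place -/

section LocalTorsion

variable {K : Type u} [Field K] [NumberField K] (W : WeierstrassCurve K) [W.IsElliptic] (p : ℕ) [Fact p.Prime]

/-- **The `Γ_{K_v}`-fixed points of `E[p^∞]` are killed by ONE power of `p`** (any finite place `v`): `p^a` where
`[E(K_v) : U] = p^a·u`, `p ∤ u`, for a torsion-free finite-index subgroup `U ≤ E(K_v)` (Silverman VII.6.3); the fixed points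
of `E[p^j]|_{Γ_{K_v}}` are the rational `p^j`-torsion points (Galois descent). [cite: SilvermanAEC2009, Prop. VII.6.3 and VIII.§1]
[cite: MilneADT2006, I Lemma 3.3] -/
theorem exists_pow_nsmul_eq_zero_of_fixed_toLocal (v : HeightOneSpectrum (𝓞 K)) :
    ∃ e : ℕ, ∀ x : W.geomPrimaryTorsion p,
      (∀ σ : absoluteGaloisGroup (v.adicCompletion K), GaloisRep.toLocal v (primaryGaloisModule W p) σ x = x) →
        p ^ e • x = 0 := by
  have hp : p.Prime := Fact.out
  haveI : CharZero (v.adicCompletion K) := charZero_adicCompletion v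
  obtain ⟨U, hU, htf, -⟩ := W.exists_finiteIndex_torsionFree_adicCompletion v
  haveI := hU
  have ht0 : U.index ≠ 0 := AddSubgroup.FiniteIndex.index_ne_zero
  obtain ⟨a, u, hu, ht⟩ := Nat.exists_eq_pow_mul_and_not_dvd ht0 p hp.ne_one
  refine ⟨a, fun x hx => ?_⟩
  -- `x ∈ E[p^j]`
  obtain ⟨j, hj⟩ := (AddCommGroup.mem_primaryComponent).mp x.2
  haveI : NeZero (p ^ j) := ⟨pow_ne_zero j hp.ne_zero⟩
  have hn : ((p ^ j : ℕ) : ℤ) ≠ 0 := by exact_mod_cast (NeZero.ne (p ^ j))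
  have hxj : p ^ j • x = 0 := Subtype.ext (by rw [AddSubmonoidClass.coe_nsmul, hj, ZeroMemClass.coe_zero])
  obtain ⟨y, hy⟩ := exists_primaryInclusion_eq_of_nsmul_eq_zero W p j x hxj
  -- `y` is `Γ_{K_v}`-invariant
  have hι : ∀ (σ : absoluteGaloisGroup (v.adicCompletion K)) (T : W.geomTorsion ((p ^ j : ℕ) : ℤ)),
      primaryInclusion W p j (GaloisRep.toLocal v (W.torsionGaloisModule ((p ^ j : ℕ) : ℤ)) σ T) =
        GaloisRep.toLocal v (primaryGaloisModule W p) σ (primaryInclusion W p j T) := by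
    intro σ T
    have h := ((primaryInclusion W p j).restrictField (v.adicCompletion K)).isIntertwining σ T
    rwa [ContinuousRep.toContRepresentation_apply_apply, ContinuousRep.toContRepresentation_apply_apply,
      ContIntertwiningMap.restrictField_apply, ContIntertwiningMap.restrictField_apply] at h
  have hyinv : y ∈ (GaloisRep.restrictField (v.adicCompletion K) (W.torsionGaloisModule ((p ^ j : ℕ) : ℤ))).invariants := by
    rw [ContinuousRep.mem_invariants]
    intro σ
    apply primaryInclusion_injective W p j
    have h := hι σ y
    rw [hy, hx σ] at h
    rw [hy]
    exact h
  -- the rational `p^j`-torsion point `P` of `E(K_v)` attached to `y`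
  set P := W.invariantsTorsionEquivKerZSMul (v.adicCompletion K) hn ⟨y, hyinv⟩ with hP
  -- `t • P = 0`: `t • P ∈ U` is torsion, `U` is torsion-free
  have htP : U.index • (P : (W.baseChange (v.adicCompletion K)).toAffine.Point) = 0 := by
    have hmem : U.index • (P : (W.baseChange (v.adicCompletion K)).toAffine.Point) ∈ U :=
      U.nsmul_index_mem _
    refine htf (p ^ j) (NeZero.ne _) _ hmem ?_
    have hPn : ((p ^ j : ℕ) : ℤ) • (P : (W.baseChange (v.adicCompletion K)).toAffine.Point) = 0 := P.2
    rw [natCast_zsmul] at hPn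
    rw [smul_comm, hPn, smul_zero]
  -- hence `t • y = 0` and `t • x = 0`
  have hty : U.index • y = 0 := by
    have h1 : U.index • (⟨y, hyinv⟩ :
        (GaloisRep.restrictField (v.adicCompletion K) (W.torsionGaloisModule ((p ^ j : ℕ) : ℤ))).invariants) = 0 := by
      apply (W.invariantsTorsionEquivKerZSMul (v.adicCompletion K) hn).injective
      rw [map_nsmul, map_zero]
      exact Subtype.ext (by rw [AddSubmonoidClass.coe_nsmul, ZeroMemClass.coe_zero]; exact htP)
    have h2 := congrArg (fun z : (GaloisRep.restrictField (v.adicCompletion K)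
      (W.torsionGaloisModule ((p ^ j : ℕ) : ℤ))).invariants => (z : W.geomTorsion ((p ^ j : ℕ) : ℤ))) h1
    exact h2
  have htx : U.index • x = 0 := by rw [← hy, ← map_nsmul, hty, map_zero]
  -- `p^a • x = 0`: `z = p^a • x` is killed by `u` and by `p^j`, `gcd(u, p^j) = 1`
  set z := p ^ a • x with hz
  have huz : u • z = 0 := by rw [hz, ← mul_smul, mul_comm, ← ht]; exact htx
  have hpz : p ^ j • z = 0 := by rw [hz, smul_comm, hxj, smul_zero]
  have hcop : Nat.Coprime u (p ^ j) := (Nat.Coprime.pow_left j ((Nat.Prime.coprime_iff_not_dvd hp).2 hu)).symm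
  have h1 : addOrderOf z ∣ 1 := by
    rw [← hcop]
    exact Nat.dvd_gcd (addOrderOf_dvd_iff_nsmul_eq_zero.2 huz) (addOrderOf_dvd_iff_nsmul_eq_zero.2 hpz)
  exact AddMonoid.addOrderOf_eq_one_iff.1 (Nat.dvd_one.1 h1)

end LocalTorsion

/-! ## §2 The counts of parts 6–7 with (heP) discharged -/

section Final

variable {K : Type} [Field K] [NumberField K] (W : WeierstrassCurve K) [W.IsElliptic] (p : ℕ) [Fact p.Prime]

/-- **Kato's (14.9.3) count for all large levels, over any number field `K : Type`** — part 6 with the local torsion bound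
(heP) DISCHARGED (`exists_pow_nsmul_eq_zero_of_fixed_toLocal`, uniform over the finite set `P`).  Hypotheses left: `p` odd,
`P ⊆ T` finite with `P ⊇ {v ∣ p}` (`hPp`), good reduction and `p ∉ v` outside `T`, Kato's strict structure `𝓢∞` on `E[p^∞]`
with `Sel_str^{ur}(K,E[p^∞]) = H¹_{𝓢∞}` FINITE, `v₀ ∈ P`; conclusion: `∃ k₀ ∀ k ≥ k₀`, for every Poitou–Tate family at level
`p^k` and every Kato pair `𝓢 ≤ ℛ` on `E[p^k]`, **`#H¹_ℛ(K,E[p^k]) = #Sel_str^{ur}(K,E[p^∞])·∏_{v∈P}#𝓚_v`**.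
[cite: Kato2004Asterisque, (14.9.3)–(14.9.4) (p. 240) and Prop. 14.16 (p. 244)] -/
theorem exists_forall_le_natCard_selmerGroup_relaxed_eq' (hodd : p ≠ 2) (P T : Finset (HeightOneSpectrum (𝓞 K)))
    (hPT : P ⊆ T) (hT : ∀ v : HeightOneSpectrum (𝓞 K), v ∉ T → (p : 𝓞 K) ∉ v.asIdeal ∧ W.HasGoodReductionAt v)
    (hPp : ∀ v : HeightOneSpectrum (𝓞 K), (p : 𝓞 K) ∈ v.asIdeal → v ∈ P)
    (𝓢inf : SelmerStructure (primaryGaloisModule W p)) [Finite 𝓢inf.selmerGroup]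
    (hIP : ∀ v ∈ P, 𝓢inf (Sum.inr v) = ⊥)
    (hIur : ∀ v ∉ P, 𝓢inf (Sum.inr v) = unramifiedSubgroup (GaloisRep.toLocal v (primaryGaloisModule W p)) 1)
    (hIinl : ∀ w : InfinitePlace K, 𝓢inf (Sum.inl w) = ⊤) {v₀ : HeightOneSpectrum (𝓞 K)} (hv₀P : v₀ ∈ P) :
    ∃ k₀ : ℕ, ∀ k, k₀ ≤ k →
      ∀ (inv : LocalInvariants K (p ^ k)), inv.IsPerfect → inv.SumLocalTermEqZero → inv.SelmerComplement →
      ∀ (𝓢 ℛ : SelmerStructure (W.torsionGaloisModule ((p ^ k : ℕ) : ℤ))),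
        (∀ v ∈ P, 𝓢 (Sum.inr v) = ⊥) → (∀ v ∈ P, ℛ (Sum.inr v) = ⊤) →
        (∀ v ∉ P, 𝓢 (Sum.inr v) = unramifiedSubgroup (GaloisRep.toLocal v (W.torsionGaloisModule ((p ^ k : ℕ) : ℤ))) 1) →
        (∀ v ∉ P, ℛ (Sum.inr v) = unramifiedSubgroup (GaloisRep.toLocal v (W.torsionGaloisModule ((p ^ k : ℕ) : ℤ))) 1) →
        Nat.card ℛ.selmerGroup =
          Nat.card 𝓢inf.selmerGroup * ∏ v ∈ P, Nat.card (W.kummerSelmerStructure ((p ^ k : ℕ) : ℤ) (Sum.inr v)) := by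
  -- a uniform local torsion exponent over the finite set `P`
  choose e he using fun v : HeightOneSpectrum (𝓞 K) => exists_pow_nsmul_eq_zero_of_fixed_toLocal W p v
  have heP : ∃ eP : ℕ, ∀ v ∈ P, ∀ x : W.geomPrimaryTorsion p,
      (∀ σ : absoluteGaloisGroup (v.adicCompletion K), GaloisRep.toLocal v (primaryGaloisModule W p) σ x = x) →
        p ^ eP • x = 0 := by
    refine ⟨P.sup e, fun v hv x hx => ?_⟩
    rw [← Nat.sub_add_cancel (Finset.le_sup hv : e v ≤ P.sup e), pow_add, mul_smul, he v x hx, smul_zero]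
  exact exists_forall_le_natCard_selmerGroup_relaxed_eq W p hodd P T hPT hT hPp 𝓢inf hIP hIur hIinl heP hv₀P

/-- **Kato's (14.9.3) count over `ℚ` for all large levels, (heP) discharged**: for `E/ℚ`, `p` odd, `T ∋ v_p` with good
reduction outside, and `Sel_str^{ur}(ℚ,E[p^∞])` finite: `∃ k₀ ∀ k ≥ k₀`, for every Poitou–Tate family at level `p^k` and every
Kato pair `𝓢 ≤ ℛ` on `E[p^k]` (zero / everything at `v_p`, unramified at every other prime),
**`#H¹_ℛ(ℚ,E[p^k]) = #Sel_str^{ur}(ℚ,E[p^∞]) · #E(ℚ_{v_p})[p^k] · p^k`**. [cite: Kato2004Asterisque, (14.9.3)–(14.9.4) (p. 240) and Prop. 14.16 (p. 244)]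
[cite: MilneADT2006, I Lemma 3.3] -/
theorem exists_forall_le_natCard_selmerGroup_relaxed_eq_rat' (W : WeierstrassCurve ℚ) [W.IsElliptic] (hodd : p ≠ 2)
    (T : Finset (HeightOneSpectrum (𝓞 ℚ))) (hpT : primePlace p ∈ T)
    (hT : ∀ v : HeightOneSpectrum (𝓞 ℚ), v ∉ T → W.HasGoodReductionAt v)
    (𝓢inf : SelmerStructure (primaryGaloisModule W p)) [Finite 𝓢inf.selmerGroup]
    (hIP : 𝓢inf (Sum.inr (primePlace p)) = ⊥)
    (hIur : ∀ v : HeightOneSpectrum (𝓞 ℚ), v ≠ primePlace p →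
      𝓢inf (Sum.inr v) = unramifiedSubgroup (GaloisRep.toLocal v (primaryGaloisModule W p)) 1)
    (hIinl : ∀ w : InfinitePlace ℚ, 𝓢inf (Sum.inl w) = ⊤) :
    ∃ k₀ : ℕ, ∀ k, k₀ ≤ k →
      ∀ (inv : LocalInvariants ℚ (p ^ k)), inv.IsPerfect → inv.SumLocalTermEqZero → inv.SelmerComplement →
      ∀ (𝓢 ℛ : SelmerStructure (W.torsionGaloisModule ((p ^ k : ℕ) : ℤ))),
        𝓢 (Sum.inr (primePlace p)) = ⊥ → ℛ (Sum.inr (primePlace p)) = ⊤ →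
        (∀ v : HeightOneSpectrum (𝓞 ℚ), v ≠ primePlace p →
          𝓢 (Sum.inr v) = unramifiedSubgroup (GaloisRep.toLocal v (W.torsionGaloisModule ((p ^ k : ℕ) : ℤ))) 1) →
        (∀ v : HeightOneSpectrum (𝓞 ℚ), v ≠ primePlace p →
          ℛ (Sum.inr v) = unramifiedSubgroup (GaloisRep.toLocal v (W.torsionGaloisModule ((p ^ k : ℕ) : ℤ))) 1) →
        Nat.card ℛ.selmerGroup =
          Nat.card 𝓢inf.selmerGroup *
            (Nat.card (nsmulAddMonoidHom (p ^ k) :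
              (W.baseChange ((primePlace p).adicCompletion ℚ)).toAffine.Point →+ _).ker * p ^ k) :=
  exists_forall_le_natCard_selmerGroup_relaxed_eq_rat W p hodd T hpT hT 𝓢inf hIP hIur hIinl
    (exists_pow_nsmul_eq_zero_of_fixed_toLocal W p (primePlace p))

end Final

end Summit.BirchSwinnertonDyer.BirchSwinnertonDyer.Theorems.KatoFiniteLevelCount

end
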